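import Summits.Ventures.YMGap.RobustBall.HaarSecondMoments
import HarnessLib

/-!
# The Haar moments of bidegree `(2,2)` of the ENTRIES of `SU(N)`, every `N ≥ 3`: `∫ |U₀₀|⁴ dU = 2/(N(N+1))` and
# `∫ |U₀₀|²|U₀₁|² dU = 1/(N(N+1))` (row type C-PRESS, `β = 0` inputs, part 19a)

Cell `pub-ymgap`, seat ds-1 (gen 11). HONEST FRAMING: pure compact-group integration for a compact group `G ≅ SU(N)`
(`IsSpecialUnitaryModel ρ`), `N = 2 + n ≥ 3`; nothing lattice-specific, nothing about the continuum or the Clay problem. Kernel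
theorems only, 0 compute, no definitions (the rotation is a local notation for an explicit matrix).

These are the second Weingarten values of `U(N)`/`SU(N)` (Creutz (8.22)), obtained WITHOUT Weingarten calculus, by invariance alone, in
the style of `RobustBall.HaarSecondMoments` (bidegree `(1,1)`) plus ONE non-monomial group element:
* `rotMatrix n c s` (local notation) — the real rotation `((c, −s), (s, c)) ⊕ 1_n ∈ SU(2+n)` (`c² + s² = 1`; built with `Matrix.fromBlocks` and
  `finSumFinEquiv`); right multiplication mixes the columns `0, 1`: `(U R)_{a0} = c U_{a0} + s U_{a1}` (`mul_rotMatrix_apply`);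
* the right phase twist `diag(i at 0, −i at 2)` kills `K = ∫ Re((U₀₀ Ū₀₁)²)` (`integral_sq_entry_mul_conj_entry`; needs the third index);
* the rotations `(3 ± 4·e)/5`: `∫ |(3U₀₀ ± 4U₀₁)/5|⁴ = ∫ |U₀₀|⁴`; adding the signs: `A := ∫|U₀₀|⁴ = 2 B`, `B := ∫ |U₀₀|²|U₀₁|²`
  (`integral_normSq_sq_eq_two_mul`);
* the unitarity row sum (`Σ_j |U₀ⱼ|² = 1`, signed column swaps): `A + (N−1)B = ∫|U₀₀|² = 1/N`, hence ★★ `A = 2/(N(N+1))`,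
  ★ `B = 1/(N(N+1))` (`integral_normSq_sq`, `integral_normSq_mul_normSq_row`; concretely `integral_normSq_sq_suN`).
Part 19b (`HaarFourthMomentSUNCross`) continues down column `0` and along row `1` (`∫|U₀₀|²|U₁₀|² = 1/(N(N+1))`,
`∫|U₀₀|²|U₁₁|² = 1/(N²−1)`); the intended use is `∫ |tr U|⁴ dU = 2` for every `N ≥ 3` (not drawn here). References: M. Creutz,
*Quarks, gluons and lattices* (1983) §8 eq. (8.22); B. Collins, IMRN 2003 (Weingarten). Everything here is proved. [folklore]
-/

noncomputable section

open MeasureTheory Complex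
open Literature.MathematicalPhysics.QuantumLattice Literature.MathematicalPhysics.QuantumFieldTheory
open scoped Matrix

namespace Summit.Ventures.YMGap.HaarFourthMomentSUN

open RobustBall.HaarSecondMoments (integral_comp_mul_left integral_comp_mul_right diagonal_phase_mem swap_mul_sign_mem
  integral_eq_zero_of_neg integral_normSq_entry re_sq_eq)

/-! ### The rotation in the `(0,1)` coordinate plane as an element of `SU(2+n)` -/

/-- Local shorthand: the real rotation block `((c, −s), (s, c))` as a complex `2 × 2` matrix. -/
local notation3 (prettyPrint := false) "rotBlock" c:max s:max =>
  (Matrix.of ![![((c : ℝ) : ℂ), -((s : ℝ) : ℂ)], ![((s : ℝ) : ℂ), ((c : ℝ) : ℂ)]] : Matrix (Fin 2) (Fin 2) ℂ)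

/-- Local shorthand: the rotation by `(c, s)` in the coordinate plane `(0, 1)` of `ℂ^{2+n}`, `rotBlock c s ⊕ 1_n`. -/
local notation3 (prettyPrint := false) "rotMatrix" n:max c:max s:max =>
  Matrix.reindex finSumFinEquiv finSumFinEquiv
    (Matrix.fromBlocks (rotBlock c s) 0 0 (1 : Matrix (Fin n) (Fin n) ℂ))

section Rotation

/-- The rotation block is unitary when `c² + s² = 1`. [folklore] -/
theorem rotBlock_mul_conjTranspose (c s : ℝ) (h : c ^ 2 + s ^ 2 = 1) :
    rotBlock c s * (rotBlock c s)ᴴ = 1 := by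
  ext i j
  fin_cases i <;> fin_cases j <;>
    simp [Matrix.mul_apply, Fin.sum_univ_two, Matrix.conjTranspose_apply, Complex.conj_ofReal]
  all_goals (norm_cast; nlinarith [h])

/-- The rotation block has determinant `c² + s² = 1`. [folklore] -/
theorem det_rotBlock (c s : ℝ) (h : c ^ 2 + s ^ 2 = 1) : (rotBlock c s).det = 1 := by
  have h' : (c : ℂ) ^ 2 + (s : ℂ) ^ 2 = 1 := by exact_mod_cast h
  rw [Matrix.det_fin_two]
  simp
  linear_combination h'

/-- **The rotation `rotMatrix n c s` lies in `SU(2+n)`** (`c² + s² = 1`). [folklore] -/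
theorem rotMatrix_mem (n : ℕ) {c s : ℝ} (h : c ^ 2 + s ^ 2 = 1) :
    rotMatrix n c s ∈ Matrix.specialUnitaryGroup (Fin (2 + n)) ℂ := by
  rw [Matrix.mem_specialUnitaryGroup_iff]
  refine ⟨?_, ?_⟩
  · rw [Matrix.mem_unitaryGroup_iff, Matrix.star_eq_conjTranspose, Matrix.reindex_apply,
      Matrix.conjTranspose_submatrix, Matrix.submatrix_mul_equiv, Matrix.fromBlocks_conjTranspose,
      Matrix.fromBlocks_multiply]
    simp only [Matrix.conjTranspose_zero, Matrix.conjTranspose_one, Matrix.mul_zero, Matrix.zero_mul, add_zero,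
      zero_add, Matrix.mul_one, rotBlock_mul_conjTranspose c s h]
    rw [Matrix.fromBlocks_one, Matrix.submatrix_one_equiv]
  · rw [Matrix.reindex_apply, Matrix.det_submatrix_equiv_self, Matrix.det_fromBlocks_zero₂₁, det_rotBlock c s h,
      Matrix.det_one, mul_one]

/-- **Right multiplication by the rotation mixes the columns `0, 1`**: `(M R)_{a0} = c M_{a0} + s M_{a1}` and
`(M R)_{a1} = −s M_{a0} + c M_{a1}`. [folklore] -/
theorem mul_rotMatrix_apply (n : ℕ) (c s : ℝ) (M : Matrix (Fin (2 + n)) (Fin (2 + n)) ℂ) (a : Fin (2 + n)) :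
    (M * rotMatrix n c s) a 0 = (c : ℂ) * M a 0 + (s : ℂ) * M a 1 ∧
      (M * rotMatrix n c s) a 1 = -(s : ℂ) * M a 0 + (c : ℂ) * M a 1 := by
  have e0 : (0 : Fin (2 + n)) = Fin.castAdd n (0 : Fin 2) := rfl
  have e1 : (1 : Fin (2 + n)) = Fin.castAdd n (1 : Fin 2) := by
    ext; simp [Nat.mod_eq_of_lt (show 1 < 2 + n by omega)]
  have key : ∀ j : Fin 2, (M * rotMatrix n c s) a (Fin.castAdd n j) =
      ∑ i : Fin 2, M a (Fin.castAdd n i) * (rotBlock c s) i j := by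
    intro j
    rw [Matrix.mul_apply, Fin.sum_univ_add]
    have h1 : ∀ i : Fin 2, (rotMatrix n c s) (Fin.castAdd n i) (Fin.castAdd n j) = (rotBlock c s) i j := by
      intro i; simp
    have h2 : ∀ k : Fin n, (rotMatrix n c s) (Fin.natAdd 2 k) (Fin.castAdd n j) = 0 := by
      intro k; simp
    simp only [h1, h2, mul_zero, Finset.sum_const_zero, add_zero]
  rw [e0, e1, key, key, Fin.sum_univ_two, Fin.sum_univ_two]
  simp [← e0, ← e1]
  constructor <;> ring

end Rotation

/-! ### The moments of bidegree `(2,2)` -/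

section Moments

variable {n : ℕ} {G : Type*} [Group G] [TopologicalSpace G] [IsTopologicalGroup G] [CompactSpace G]
  [MeasurableSpace G] [BorelSpace G] (ρ : G →* Matrix (Fin (2 + n)) (Fin (2 + n)) ℂ)

/-- Real-valued polynomial functions of the entries are Haar integrable (continuity on a compact group). [folklore] -/
theorem integrable_of_continuous' (_hρ : Continuous ρ) {f : G → ℝ} (hf : Continuous f) :
    Integrable f (haarProbability G) :=
  hf.integrable_of_hasCompactSupport (HasCompactSupport.of_compactSpace _)

omit [IsTopologicalGroup G] [CompactSpace G] [MeasurableSpace G] [BorelSpace G] in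
/-- Continuity of `g ↦ |ρ(g)_{ai}|²`. [folklore] -/
theorem continuous_normSq_entry (hρ : Continuous ρ) (a i : Fin (2 + n)) :
    Continuous fun g => Complex.normSq (ρ g a i) :=
  Complex.continuous_normSq.comp (hρ.matrix_elem a i)

/-- **`∫ |ρ(g)₀₀|² dg = 1/N`** in real form. [folklore] -/
theorem integral_normSq_entry_real (hρ : IsSpecialUnitaryModel ρ) (a i : Fin (2 + n)) :
    ∫ g, Complex.normSq (ρ g a i) ∂haarProbability G = 1 / (2 + n : ℝ) := by
  have h := integral_normSq_entry ρ hρ a i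
  simp_rw [Complex.mul_conj] at h
  rw [integral_complex_ofReal] at h
  have h' : ((∫ g, Complex.normSq (ρ g a i) ∂haarProbability G : ℝ) : ℂ) = ((1 / (2 + n : ℝ) : ℝ) : ℂ) := by
    rw [h]; push_cast; rw [one_div]
  exact_mod_cast h'

/-- **The cross term vanishes: `∫ (ρ(g)₀₀ conj ρ(g)₀₁)² dg = 0`** for `N ≥ 3` (right phase twist `diag(i at 0, −i at 2)`: the
integrand changes sign). [folklore] -/
theorem integral_sq_entry_mul_conj_entry (hρ : IsSpecialUnitaryModel ρ) (hn : 1 ≤ n) :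
    ∫ g, (ρ g 0 0 * (starRingEnd ℂ) (ρ g 0 1)) ^ 2 ∂haarProbability G = 0 := by
  set t : Fin (2 + n) := ⟨2, by omega⟩ with ht
  have h0t : (0 : Fin (2 + n)) ≠ t := fun h => by
    have := congrArg Fin.val h; rw [ht] at this; simp at this
  have h1t : (1 : Fin (2 + n)) ≠ t := fun h => by
    have := congrArg Fin.val h; rw [ht] at this
    simp [Nat.mod_eq_of_lt (show 1 < 2 + n by omega)] at this
  have h10 : (1 : Fin (2 + n)) ≠ 0 := fun h => by
    have := congrArg Fin.val h; simp [Nat.mod_eq_of_lt (show 1 < 2 + n by omega)] at this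
  set D := Matrix.diagonal (Pi.mulSingle 0 Complex.I * Pi.mulSingle t (-Complex.I) : Fin (2 + n) → ℂ) with hD
  have hDm : D ∈ Matrix.specialUnitaryGroup (Fin (2 + n)) ℂ := by rw [hD]; exact diagonal_phase_mem 0 t h0t
  have h := integral_comp_mul_right ρ hρ hDm (fun M => (M 0 0 * (starRingEnd ℂ) (M 0 1)) ^ 2)
  have hD0 : ∀ M : Matrix (Fin (2 + n)) (Fin (2 + n)) ℂ, (M * D) 0 0 = M 0 0 * Complex.I := fun M => by
    rw [hD, Matrix.mul_diagonal]; simp [Pi.mulSingle_eq_of_ne h0t]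
  have hD1 : ∀ M : Matrix (Fin (2 + n)) (Fin (2 + n)) ℂ, (M * D) 0 1 = M 0 1 := fun M => by
    rw [hD, Matrix.mul_diagonal]; simp [Pi.mulSingle_eq_of_ne h1t, Pi.mulSingle_eq_of_ne h10]
  have hpt : ∀ M : Matrix (Fin (2 + n)) (Fin (2 + n)) ℂ,
      ((M * D) 0 0 * (starRingEnd ℂ) ((M * D) 0 1)) ^ 2 = -((M 0 0 * (starRingEnd ℂ) (M 0 1)) ^ 2) := fun M => by
    rw [hD0, hD1]
    linear_combination ((M 0 0 * (starRingEnd ℂ) (M 0 1)) ^ 2) * Complex.I_mul_I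
  simp only [hpt] at h
  exact integral_eq_zero_of_neg h

/-- `∫ Re(ρ₀₀ conj ρ₀₁)² dg = (∫ |ρ₀₀|²|ρ₀₁|² dg)/2` (`(Re z)² = (|z|² + Re z²)/2` and the cross term vanishes). [folklore] -/
theorem integral_re_sq (hρ : IsSpecialUnitaryModel ρ) (hn : 1 ≤ n) :
    ∫ g, (ρ g 0 0 * (starRingEnd ℂ) (ρ g 0 1)).re ^ 2 ∂haarProbability G =
      (∫ g, Complex.normSq (ρ g 0 0) * Complex.normSq (ρ g 0 1) ∂haarProbability G) / 2 := by
  have hc : Continuous fun g : G => ρ g 0 0 * (starRingEnd ℂ) (ρ g 0 1) :=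
    (hρ.1.matrix_elem 0 0).mul (Complex.continuous_conj.comp (hρ.1.matrix_elem 0 1))
  simp_rw [re_sq_eq, Complex.normSq_mul, Complex.normSq_conj]
  have hi1 : Integrable (fun g => Complex.normSq (ρ g 0 0) * Complex.normSq (ρ g 0 1)) (haarProbability G) :=
    integrable_of_continuous' ρ hρ.1 ((continuous_normSq_entry ρ hρ.1 0 0).mul (continuous_normSq_entry ρ hρ.1 0 1))
  have hi2c : Integrable (fun g => (ρ g 0 0 * (starRingEnd ℂ) (ρ g 0 1)) ^ 2) (haarProbability G) :=
    (hc.pow 2).integrable_of_hasCompactSupport (HasCompactSupport.of_compactSpace _)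
  have hi2 : Integrable (fun g => ((ρ g 0 0 * (starRingEnd ℂ) (ρ g 0 1)) ^ 2).re) (haarProbability G) := hi2c.re
  rw [integral_div, integral_add hi1 hi2]
  have e2 : ∫ g, ((ρ g 0 0 * (starRingEnd ℂ) (ρ g 0 1)) ^ 2).re ∂haarProbability G = 0 := by
    have h := integral_re hi2c
    rw [integral_sq_entry_mul_conj_entry ρ hρ hn] at h
    simpa using h
  rw [e2, add_zero]

/-- `∫ |ρ₀₁|⁴ = ∫ |ρ₀₀|⁴` (right signed transposition of the columns `0, 1`). [folklore] -/
theorem integral_normSq_sq_col_one (hρ : IsSpecialUnitaryModel ρ) :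
    ∫ g, Complex.normSq (ρ g 0 1) ^ 2 ∂haarProbability G = ∫ g, Complex.normSq (ρ g 0 0) ^ 2 ∂haarProbability G := by
  have h10 : (1 : Fin (2 + n)) ≠ 0 := fun h => by
    have := congrArg Fin.val h; simp [Nat.mod_eq_of_lt (show 1 < 2 + n by omega)] at this
  set T := Matrix.swap ℂ (0 : Fin (2 + n)) 1 * Matrix.diagonal (Pi.mulSingle 0 (-1 : ℂ)) with hT
  have hTm : T ∈ Matrix.specialUnitaryGroup (Fin (2 + n)) ℂ := by rw [hT]; exact swap_mul_sign_mem 0 1 h10.symm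
  have h := integral_comp_mul_right ρ hρ hTm (fun M => Complex.normSq (M 0 0) ^ 2)
  have hTa : ∀ M : Matrix (Fin (2 + n)) (Fin (2 + n)) ℂ, (M * T) 0 0 = -M 0 1 := fun M => by
    rw [hT, ← Matrix.mul_assoc, Matrix.mul_diagonal, Matrix.mul_swap_apply_left]; simp
  have hpt : ∀ M : Matrix (Fin (2 + n)) (Fin (2 + n)) ℂ, Complex.normSq ((M * T) 0 0) ^ 2 = Complex.normSq (M 0 1) ^ 2 :=
    fun M => by rw [hTa, Complex.normSq_neg]
  simp only [hpt] at h
  exact h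

/-- ★ **`∫ |ρ₀₀|⁴ dg = 2 ∫ |ρ₀₀|²|ρ₀₁|² dg`** for `N ≥ 3` — the one genuinely fourth-order relation, from the rotations `(3 ± 4e)/5` in
the column plane `(0, 1)`. [folklore] -/
theorem integral_normSq_sq_eq_two_mul (hρ : IsSpecialUnitaryModel ρ) (hn : 1 ≤ n) :
    ∫ g, Complex.normSq (ρ g 0 0) ^ 2 ∂haarProbability G =
      2 * ∫ g, Complex.normSq (ρ g 0 0) * Complex.normSq (ρ g 0 1) ∂haarProbability G := by
  -- notation: X = |U₀₀|², Y = |U₀₁|², W = Re(U₀₀ conj U₀₁)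
  set X : G → ℝ := fun g => Complex.normSq (ρ g 0 0) with hX
  set Y : G → ℝ := fun g => Complex.normSq (ρ g 0 1) with hY
  set W : G → ℝ := fun g => (ρ g 0 0 * (starRingEnd ℂ) (ρ g 0 1)).re with hW
  have cX : Continuous X := continuous_normSq_entry ρ hρ.1 0 0
  have cY : Continuous Y := continuous_normSq_entry ρ hρ.1 0 1
  have cW : Continuous W :=
    Complex.continuous_re.comp ((hρ.1.matrix_elem 0 0).mul (Complex.continuous_conj.comp (hρ.1.matrix_elem 0 1)))
  -- the rotated entry: |c U₀₀ + s U₀₁|² = c² X + s² Y + 2cs W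
  have hns : ∀ (c s : ℝ) (g : G), Complex.normSq ((c : ℂ) * ρ g 0 0 + (s : ℂ) * ρ g 0 1) =
      c ^ 2 * X g + s ^ 2 * Y g + 2 * c * s * W g := by
    intro c s g
    simp only [hX, hY, hW, Complex.normSq_apply, Complex.add_re, Complex.add_im, Complex.mul_re, Complex.mul_im,
      Complex.ofReal_re, Complex.ofReal_im, Complex.conj_re, Complex.conj_im]
    ring
  -- Haar invariance under the two rotations
  have hrot : ∀ (c s : ℝ), c ^ 2 + s ^ 2 = 1 →
      ∫ g, (c ^ 2 * X g + s ^ 2 * Y g + 2 * c * s * W g) ^ 2 ∂haarProbability G = ∫ g, X g ^ 2 ∂haarProbability G := by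
    intro c s hcs
    have h := integral_comp_mul_right ρ hρ (rotMatrix_mem n hcs) (fun M => Complex.normSq (M 0 0) ^ 2)
    have hpt : ∀ g : G, Complex.normSq ((ρ g * rotMatrix n c s) 0 0) ^ 2 =
        (c ^ 2 * X g + s ^ 2 * Y g + 2 * c * s * W g) ^ 2 := fun g => by
      rw [(mul_rotMatrix_apply n c s (ρ g) 0).1, hns]
    simp only [hpt] at h
    exact h
  have hm := hrot (3 / 5) (4 / 5) (by norm_num)
  have hp := hrot (3 / 5) (-(4 / 5)) (by norm_num)
  -- add the two signs: odd terms cancel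
  have iX2 : Integrable (fun g => X g ^ 2) (haarProbability G) := integrable_of_continuous' ρ hρ.1 (by fun_prop)
  have iY2 : Integrable (fun g => Y g ^ 2) (haarProbability G) := integrable_of_continuous' ρ hρ.1 (by fun_prop)
  have iXY : Integrable (fun g => X g * Y g) (haarProbability G) := integrable_of_continuous' ρ hρ.1 (by fun_prop)
  have iW2 : Integrable (fun g => W g ^ 2) (haarProbability G) := integrable_of_continuous' ρ hρ.1 (by fun_prop)
  have i1 : Integrable (fun g => ((3 / 5 : ℝ) ^ 2 * X g + (4 / 5 : ℝ) ^ 2 * Y g + 2 * (3 / 5) * (4 / 5) * W g) ^ 2)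
      (haarProbability G) := integrable_of_continuous' ρ hρ.1 (by fun_prop)
  have i2 : Integrable (fun g => ((3 / 5 : ℝ) ^ 2 * X g + (-(4 / 5) : ℝ) ^ 2 * Y g + 2 * (3 / 5) * (-(4 / 5)) * W g) ^ 2)
      (haarProbability G) := integrable_of_continuous' ρ hρ.1 (by fun_prop)
  have hsum : ∫ g, (((3 / 5 : ℝ) ^ 2 * X g + (4 / 5 : ℝ) ^ 2 * Y g + 2 * (3 / 5) * (4 / 5) * W g) ^ 2 +
      ((3 / 5 : ℝ) ^ 2 * X g + (-(4 / 5) : ℝ) ^ 2 * Y g + 2 * (3 / 5) * (-(4 / 5)) * W g) ^ 2) ∂haarProbability G =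
      2 * ∫ g, X g ^ 2 ∂haarProbability G := by
    rw [integral_add i1 i2, hm, hp]; ring
  have hpt : ∀ g : G, ((3 / 5 : ℝ) ^ 2 * X g + (4 / 5 : ℝ) ^ 2 * Y g + 2 * (3 / 5) * (4 / 5) * W g) ^ 2 +
      ((3 / 5 : ℝ) ^ 2 * X g + (-(4 / 5) : ℝ) ^ 2 * Y g + 2 * (3 / 5) * (-(4 / 5)) * W g) ^ 2 =
      (162 / 625 : ℝ) * X g ^ 2 + (576 / 625 : ℝ) * (X g * Y g) + (512 / 625 : ℝ) * Y g ^ 2 +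
        (1152 / 625 : ℝ) * W g ^ 2 := by
    intro g; ring
  simp only [hpt] at hsum
  have i12 : Integrable (fun g => (162 / 625 : ℝ) * X g ^ 2 + (576 / 625 : ℝ) * (X g * Y g)) (haarProbability G) :=
    (iX2.const_mul _).add (iXY.const_mul _)
  have i123 : Integrable (fun g => (162 / 625 : ℝ) * X g ^ 2 + (576 / 625 : ℝ) * (X g * Y g) + (512 / 625 : ℝ) * Y g ^ 2)
      (haarProbability G) := i12.add (iY2.const_mul _)
  rw [integral_add i123 (iW2.const_mul _), integral_add i12 (iY2.const_mul _),
    integral_add (iX2.const_mul _) (iXY.const_mul _), integral_const_mul, integral_const_mul, integral_const_mul,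
    integral_const_mul] at hsum
  have hY2 : ∫ g, Y g ^ 2 ∂haarProbability G = ∫ g, X g ^ 2 ∂haarProbability G := integral_normSq_sq_col_one ρ hρ
  have hW2 : ∫ g, W g ^ 2 ∂haarProbability G = (∫ g, X g * Y g ∂haarProbability G) / 2 := integral_re_sq ρ hρ hn
  rw [hY2, hW2] at hsum
  linarith

/-- `∫ |ρ₀₀|² |ρ₀ⱼ|² = ∫ |ρ₀₀|² |ρ₀₁|²` for every column `j ≠ 0` (right signed transposition `1 ↔ j`, fixing column `0`). [folklore] -/
theorem integral_normSq_mul_normSq_col (hρ : IsSpecialUnitaryModel ρ) {j : Fin (2 + n)} (hj : j ≠ 0) :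
    ∫ g, Complex.normSq (ρ g 0 0) * Complex.normSq (ρ g 0 j) ∂haarProbability G =
      ∫ g, Complex.normSq (ρ g 0 0) * Complex.normSq (ρ g 0 1) ∂haarProbability G := by
  rcases eq_or_ne j 1 with rfl | hj1
  · rfl
  have h10 : (1 : Fin (2 + n)) ≠ 0 := fun h => by
    have := congrArg Fin.val h; simp [Nat.mod_eq_of_lt (show 1 < 2 + n by omega)] at this
  set T := Matrix.swap ℂ (1 : Fin (2 + n)) j * Matrix.diagonal (Pi.mulSingle 1 (-1 : ℂ)) with hT
  have hTm : T ∈ Matrix.specialUnitaryGroup (Fin (2 + n)) ℂ := by rw [hT]; exact swap_mul_sign_mem 1 j hj1.symm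
  have h := integral_comp_mul_right ρ hρ hTm (fun M => Complex.normSq (M 0 0) * Complex.normSq (M 0 1))
  have hT1 : ∀ M : Matrix (Fin (2 + n)) (Fin (2 + n)) ℂ, (M * T) 0 1 = -M 0 j := fun M => by
    rw [hT, ← Matrix.mul_assoc, Matrix.mul_diagonal, Matrix.mul_swap_apply_left]; simp
  have hT0 : ∀ M : Matrix (Fin (2 + n)) (Fin (2 + n)) ℂ, (M * T) 0 0 = M 0 0 := fun M => by
    rw [hT, ← Matrix.mul_assoc, Matrix.mul_diagonal, Matrix.mul_swap_of_ne h10.symm hj.symm]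
    simp [Pi.mulSingle_eq_of_ne h10.symm]
  have hpt : ∀ M : Matrix (Fin (2 + n)) (Fin (2 + n)) ℂ,
      Complex.normSq ((M * T) 0 0) * Complex.normSq ((M * T) 0 1) = Complex.normSq (M 0 0) * Complex.normSq (M 0 j) :=
    fun M => by rw [hT0, hT1, Complex.normSq_neg]
  simp only [hpt] at h
  exact h

/-- **Unitarity row sum against `|ρ₀₀|²`**: `∫|ρ₀₀|⁴ + (N−1) ∫|ρ₀₀|²|ρ₀₁|² = ∫ |ρ₀₀|² = 1/N`. [folklore] -/
theorem row_sum_identity (hρ : IsSpecialUnitaryModel ρ) :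
    ∫ g, Complex.normSq (ρ g 0 0) ^ 2 ∂haarProbability G +
        (1 + n : ℝ) * ∫ g, Complex.normSq (ρ g 0 0) * Complex.normSq (ρ g 0 1) ∂haarProbability G = 1 / (2 + n : ℝ) := by
  -- Σ_j |U₀ⱼ|² = 1 pointwise
  have hrow : ∀ g : G, ∑ j, Complex.normSq (ρ g 0 j) = 1 := by
    intro g
    have hu := IsSpecialUnitaryModel.mem_unitaryGroup ρ hρ g
    rw [Matrix.mem_unitaryGroup_iff] at hu
    have h := congrFun (congrFun hu 0) 0
    rw [Matrix.mul_apply, Matrix.one_apply_eq] at h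
    have h' : ∑ j, ((Complex.normSq (ρ g 0 j) : ℝ) : ℂ) = 1 := by
      rw [← h]
      refine Finset.sum_congr rfl fun j _ => ?_
      rw [Matrix.star_apply, Complex.star_def, Complex.mul_conj]
    exact_mod_cast h'
  have hpt : ∀ g : G, Complex.normSq (ρ g 0 0) = ∑ j, Complex.normSq (ρ g 0 0) * Complex.normSq (ρ g 0 j) := by
    intro g; rw [← Finset.mul_sum, hrow g, mul_one]
  have hint : ∀ j ∈ (Finset.univ : Finset (Fin (2 + n))),
      Integrable (fun g => Complex.normSq (ρ g 0 0) * Complex.normSq (ρ g 0 j)) (haarProbability G) := fun j _ =>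
    integrable_of_continuous' ρ hρ.1 ((continuous_normSq_entry ρ hρ.1 0 0).mul (continuous_normSq_entry ρ hρ.1 0 j))
  have h1 : ∫ g, Complex.normSq (ρ g 0 0) ∂haarProbability G =
      ∑ j, ∫ g, Complex.normSq (ρ g 0 0) * Complex.normSq (ρ g 0 j) ∂haarProbability G := by
    rw [← integral_finsetSum _ hint]
    exact integral_congr_ae (Filter.Eventually.of_forall hpt)
  rw [integral_normSq_entry_real ρ hρ 0 0, ← Finset.add_sum_erase _ _ (Finset.mem_univ (0 : Fin (2 + n)))] at h1
  have hterm : ∀ j ∈ (Finset.univ : Finset (Fin (2 + n))).erase 0,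
      ∫ g, Complex.normSq (ρ g 0 0) * Complex.normSq (ρ g 0 j) ∂haarProbability G =
      ∫ g, Complex.normSq (ρ g 0 0) * Complex.normSq (ρ g 0 1) ∂haarProbability G := fun j hj =>
    integral_normSq_mul_normSq_col ρ hρ (Finset.ne_of_mem_erase hj)
  rw [Finset.sum_congr rfl hterm, Finset.sum_const, Finset.card_erase_of_mem (Finset.mem_univ _), Finset.card_univ,
    Fintype.card_fin, nsmul_eq_mul] at h1
  have hsq : ∀ g : G, Complex.normSq (ρ g 0 0) * Complex.normSq (ρ g 0 0) = Complex.normSq (ρ g 0 0) ^ 2 := fun g => by ring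
  simp only [hsq] at h1
  have hcast : ((2 + n - 1 : ℕ) : ℝ) = 1 + n := by
    rw [show 2 + n - 1 = 1 + n by omega]; push_cast; ring
  rw [hcast] at h1
  linarith

/-- ★★ **`∫ |ρ(g)₀₀|⁴ dg = 2/(N(N+1))`** for a compact group `G ≅ SU(N)`, `N ≥ 3` — the fourth moment of a coordinate of a uniform
point on the complex sphere `S^{2N−1}` (Creutz (8.22) with all indices equal). [folklore] -/
theorem integral_normSq_sq (hρ : IsSpecialUnitaryModel ρ) (hn : 1 ≤ n) :
    ∫ g, Complex.normSq (ρ g 0 0) ^ 2 ∂haarProbability G = 2 / ((2 + n : ℝ) * (3 + n)) := by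
  have h1 := row_sum_identity ρ hρ
  have h2 := integral_normSq_sq_eq_two_mul ρ hρ hn
  have hpos : (0 : ℝ) < (2 + n : ℝ) * (3 + n) := by positivity
  rw [eq_div_iff hpos.ne']
  field_simp at h1
  nlinarith [h1, h2]

/-- ★ **`∫ |ρ(g)₀₀|² |ρ(g)₀₁|² dg = 1/(N(N+1))`** (`N ≥ 3`; same row, different columns). [folklore] -/
theorem integral_normSq_mul_normSq_row (hρ : IsSpecialUnitaryModel ρ) (hn : 1 ≤ n) :
    ∫ g, Complex.normSq (ρ g 0 0) * Complex.normSq (ρ g 0 1) ∂haarProbability G = 1 / ((2 + n : ℝ) * (3 + n)) := by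
  have h1 := integral_normSq_sq ρ hρ hn
  have h2 := integral_normSq_sq_eq_two_mul ρ hρ hn
  rw [h1] at h2
  have hpos : (0 : ℝ) < (2 + n : ℝ) * (3 + n) := by positivity
  field_simp at h2 ⊢
  linarith

end Moments

/-! ### The concrete group `SU(N)`, `N ≥ 3` -/

/-- ★★ **`∫_{SU(N)} |U₀₀|⁴ dU = 2/(N(N+1))`** for every `N ≥ 3`, in the venture's vocabulary. [folklore] -/
theorem integral_normSq_sq_suN {N : ℕ} (hN : 3 ≤ N) :
    ∫ U, Complex.normSq ((U : Matrix (Fin N) (Fin N) ℂ) ⟨0, by omega⟩ ⟨0, by omega⟩) ^ 2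
        ∂haarProbability (Matrix.specialUnitaryGroup (Fin N) ℂ) = 2 / ((N : ℝ) * (N + 1)) := by
  obtain ⟨n, rfl⟩ := Nat.exists_eq_add_of_le (show 2 ≤ N by omega)
  have hn : 1 ≤ n := by omega
  have h := integral_normSq_sq (n := n) (fundamentalRep (Fin (2 + n)))
    (TorusAreaLaw.isSpecialUnitaryModel_fundamentalRep (2 + n)) hn
  simp only [fundamentalRep_apply] at h
  have e0 : (⟨0, by omega⟩ : Fin (2 + n)) = 0 := rfl
  simp only [e0]
  rw [h]
  push_cast; ring

end Summit.Ventures.YMGap.HaarFourthMomentSUN
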